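import Mathlib
import HarnessLib

/-!
# Magnen–Rivasseau–Sénéor, *Construction of YM₄ with an infrared cutoff* (CMP 155, 1993), Sect. VII p.375 tl.20: «However by parity
# a single such vertex vanishes» — the PARITY ARGUMENT for the trilinear vertex `A²∂A` PROVED abstractly: an odd functional has zero
# mean under any measure invariant under `A ↦ −A`, a functional homogeneous of odd degree (e.g. a trilinear vertex on the diagonal) is
# odd, and the centred Gaussian is such a measure

one change of variables `A ↦ −A`; nothing here is a claim about the Yang–Mills mass gap, about continuum YM₄ on T⁴, about any functional
integral of MRS beyond this symmetry, or about the Clay problem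

**Citation header (reproduction of PUBLISHED work).** J. Magnen, V. Rivasseau, R. Sénéor, *Construction of YM₄ with an infrared cutoff*,
Commun. Math. Phys. **155** (1993) 325–383 [MagnenRivasseauSeneor1993], Sect. VII «The Expansion: Bounds on Error Terms», p.375 [PDF 51]
tl.17–22 (text layer of the held scan `paper:magnen1993-cmp155-mrs-ym4-infrared-cutoff`; PDF page = journal page − 324). Cell
pub-balaban-gaps (YM blitz, track G3), seat mrs-lit-2 (gen 21); companion record `run/shared/lean/pub/pub-balaban-gaps/g3/MRS-AS-PRINTED-estimates.md`.
The surrounding power counting of the same lines is kernel-checked in `…MRS93ConvergencePowerCounting` (file 4: `Convergence.trilinear_powerCounting`,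
`quartic_powerCounting`, `two_trilinear_eq_quartic`), whose docstring lists «the parity argument» as NOT claimed — this file supplies it.

**What the paper prints (verbatim, p.375 tl.17–22).** *«The power counting of the worse vertex (which is a trilinear vertex with derivative
coupling A²∂A rather than a quartic A⁴ vertex) integrated in a box of D^{i,α} is M^{2i}M^{(3/2)(i+α)}M^{−3i−α} = M^{−(i−α)/2} (this vertex is
equipped with one factor λ). However by parity a single such vertex vanishes. Therefore we have at least two such vertices, which means the
same power counting as a single quartic vertex (of power counting M^{2(i+α)}M^{−3i−α} = M^{−(i−α)}) with coupling λ².»*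

**What this file PROVES (kernel; zero `sorry`, zero named facts).**
* §1 `integral_eq_zero_of_odd`: on any measurable additive group `G` with a measure `μ` invariant under negation (Mathlib
  `Measure.IsNegInvariant`), every real functional with `F(−A) = −F(A)` has `∫ F dμ = 0` (Mathlib's change of variables
  `integral_neg_eq_self`; no integrability hypothesis is needed, the non-integrable case being `0 = 0`).
* §2 `neg_of_homogeneous_odd`: a functional homogeneous of ODD degree `k` under real scalings (`F(c • A) = c^k F(A)`) is odd; `cubic_neg`:
  the diagonal `A ↦ T(A, A, A)` of any trilinear form is odd, and `cubic_homogeneous` (degree `3`) — the shape of the vertex `A²∂A`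
  (trilinear in the field; the derivative is linear); `quartic_even`: the diagonal of a 4-linear form is even (the `A⁴` vertex survives).
* §3 **`integral_cubic_eq_zero`** — «by parity a single such vertex vanishes»: `∫ T(A,A,A) dμ(A) = 0` for every trilinear `T` and every
  negation-invariant `μ`; `integral_homogeneous_odd_eq_zero` for any odd degree. (Two such vertices give an even degree-6 functional, to which
  nothing here applies — «Therefore we have at least two such vertices», whose power counting is file 4's `two_trilinear_eq_quartic`.)
* §4 `isNegInvariant_gaussianReal_zero`: the centred Gaussian `gaussianReal 0 v` on `ℝ` IS negation-invariant (Mathlib `gaussianReal_map_neg`),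
  so §3 applies to it (`integral_cubic_gaussianReal_eq_zero`: `∫ t·t·t·c d𝒩(0,v) = 0` for the one-dimensional cubic).
* §5 (edition v1.1) **`isNegInvariant_of_isGaussian_centred`**: EVERY CENTRED GAUSSIAN MEASURE on a separable Banach space `E`
  (Mathlib `IsGaussian μ` — every continuous linear functional has a real Gaussian law — with mean zero, `μ[L] = 0` for all `L ∈ E*`) is
  negation-invariant: `μ.map (A ↦ −A)` is again Gaussian (Mathlib instance) with `(μ.map −)[L] = −μ[L] = 0` and `Var[L; μ.map −] = Var[−L; μ]
  = Var[L; μ]`, so both measures have the characteristic functional `exp(−Var[L; μ]∕2)` and coincide (`Measure.ext_of_charFunDual`). Instances: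
  `isNegInvariant_stdGaussian` (the standard Gaussian of a finite-dimensional inner-product space) and `isNegInvariant_multivariateGaussian_zero`
  (`𝒩(0, S)` on `ℝ^ι` for ANY covariance matrix `S`); payoff `integral_eq_zero_of_odd_of_isGaussian_centred` ∕
  **`integral_cubic_eq_zero_of_isGaussian_centred`**: `∫ T(A,A,A) dμ(A) = 0` for every trilinear `T` and every centred Gaussian `μ` — the parity
  rule in the form in which p.375 uses it (a Gaussian measure `dμ_C` on the cut-off gauge fields, of whatever covariance `C`).

**Readings (declared).** (i) «by parity» = invariance of the (Gaussian, centred) functional measure under `A ↦ −A` together with the oddness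
of a single trilinear vertex; typed for an abstract negation-invariant measure on an abstract additive group — the MRS measures `dμ₀`,
`dμ_{C(t)}` are centred Gaussians (mrs-lit-1's `…MRS93GaussianReferenceMeasures`), an instance not constructed here beyond the
one-dimensional `gaussianReal 0 v` of §4 — (edition v1.1, §5) and now EVERY centred Gaussian measure in Mathlib's sense (`IsGaussian` + mean
zero) on a separable Banach space, in particular every finite-dimensional `𝒩(0, S)`; identifying MRS's cut-off functional measure with such a
measure on a concrete field space is mrs-lit-1's statement layer and is not repeated here. (ii) The vertex `A²∂A` is READ as the diagonal of a trilinear form in the field `A` (two factors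
`A`, one factor `∂A`, `∂` linear).

**What is NOT claimed.** The power counting itself (file 4), the Gaussian integration of two vertices, the construction of MRS's measures or
of the vertex as an `x`-integral, anything of Sect. VII's convergence. MRS work at fixed infrared cutoff; nothing here bears on a mass gap or
on Bałaban's programme.
-/

noncomputable section

open MeasureTheory ProbabilityTheory

namespace Literature.MathematicalPhysics.QuantumFieldTheory.MagnenRivasseauSeneor1993

namespace Parity

/-! ## §1 Odd functionals have zero mean under a negation-invariant measure -/

section odd

variable {G : Type*} [MeasurableSpace G] [AddGroup G] [MeasurableNeg G] (μ : Measure G) [μ.IsNegInvariant]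

/-- **Parity**: if `μ` is invariant under `A ↦ −A` and `F(−A) = −F(A)` then `∫ F dμ = 0`.
[cite: MagnenRivasseauSeneor1993, §VII p.375 tl.20 «by parity a single such vertex vanishes»] -/
theorem integral_eq_zero_of_odd {F : G → ℝ} (hF : ∀ A, F (-A) = -F A) : ∫ A, F A ∂μ = 0 := by
  have h1 : ∫ A, F (-A) ∂μ = ∫ A, F A ∂μ := integral_neg_eq_self F μ
  have h2 : ∫ A, F (-A) ∂μ = -∫ A, F A ∂μ := by
    simp_rw [hF]; exact integral_neg F
  linarith

end odd

/-! ## §2 Homogeneous functionals of odd degree are odd; the trilinear vertex -/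

section homogeneous

variable {V : Type*} [AddCommGroup V] [Module ℝ V]

/-- A functional homogeneous of odd degree `k` (`F(c•A) = c^k F(A)` for all real `c`) is odd.
[cite: MagnenRivasseauSeneor1993, §VII p.375 tl.17–20] -/
theorem neg_of_homogeneous_odd {F : V → ℝ} {k : ℕ} (hhom : ∀ (c : ℝ) (A : V), F (c • A) = c ^ k * F A) (hk : Odd k)
    (A : V) : F (-A) = -F A := by
  have := hhom (-1) A
  rw [neg_one_smul, hk.neg_one_pow] at this
  rw [this]; ring

/-- A functional homogeneous of even degree is even (so parity says nothing about the quartic vertex `A⁴`).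
[cite: MagnenRivasseauSeneor1993, §VII p.375 tl.20–22] -/
theorem eq_of_homogeneous_even {F : V → ℝ} {k : ℕ} (hhom : ∀ (c : ℝ) (A : V), F (c • A) = c ^ k * F A) (hk : Even k)
    (A : V) : F (-A) = F A := by
  have := hhom (-1) A
  rw [neg_one_smul, hk.neg_one_pow] at this
  rw [this]; ring

/-- The diagonal of a trilinear form — the shape of the vertex `A²∂A` (two fields and one derivative of the field, `∂` linear) — is
homogeneous of degree `3`. [cite: MagnenRivasseauSeneor1993, §VII p.375 tl.17–18] -/
theorem cubic_homogeneous (T : V →ₗ[ℝ] V →ₗ[ℝ] V →ₗ[ℝ] ℝ) (c : ℝ) (A : V) :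
    T (c • A) (c • A) (c • A) = c ^ 3 * T A A A := by
  simp only [map_smul, LinearMap.smul_apply, smul_eq_mul]; ring

/-- Hence the trilinear vertex is odd: `T(−A,−A,−A) = −T(A,A,A)`. [cite: MagnenRivasseauSeneor1993, §VII p.375 tl.20] -/
theorem cubic_neg (T : V →ₗ[ℝ] V →ₗ[ℝ] V →ₗ[ℝ] ℝ) (A : V) : T (-A) (-A) (-A) = -T A A A :=
  neg_of_homogeneous_odd (F := fun A => T A A A) (cubic_homogeneous T) (by decide) A

/-- The diagonal of a 4-linear form is homogeneous of degree `4`. [cite: MagnenRivasseauSeneor1993, §VII p.375 tl.20–22] -/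
theorem quartic_homogeneous (Q : V →ₗ[ℝ] V →ₗ[ℝ] V →ₗ[ℝ] V →ₗ[ℝ] ℝ) (c : ℝ) (A : V) :
    Q (c • A) (c • A) (c • A) (c • A) = c ^ 4 * Q A A A A := by
  simp only [map_smul, LinearMap.smul_apply, smul_eq_mul]; ring

/-- The diagonal of a 4-linear form (the `A⁴` vertex) is even. [cite: MagnenRivasseauSeneor1993, §VII p.375 tl.20–22] -/
theorem quartic_even (Q : V →ₗ[ℝ] V →ₗ[ℝ] V →ₗ[ℝ] V →ₗ[ℝ] ℝ) (A : V) : Q (-A) (-A) (-A) (-A) = Q A A A A :=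
  eq_of_homogeneous_even (F := fun A => Q A A A A) (quartic_homogeneous Q) (by decide) A

end homogeneous

/-! ## §3 «by parity a single such vertex vanishes» -/

section vertex

variable {V : Type*} [AddCommGroup V] [Module ℝ V] [MeasurableSpace V] [MeasurableNeg V] (μ : Measure V) [μ.IsNegInvariant]

/-- **p.375 tl.20 «However by parity a single such vertex vanishes»**: the expectation of a single trilinear vertex under a
negation-invariant (e.g. centred Gaussian) measure on the fields is zero. [cite: MagnenRivasseauSeneor1993, §VII p.375 tl.17–20] -/
theorem integral_cubic_eq_zero (T : V →ₗ[ℝ] V →ₗ[ℝ] V →ₗ[ℝ] ℝ) : ∫ A, T A A A ∂μ = 0 :=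
  integral_eq_zero_of_odd μ (cubic_neg T)

/-- The same for any functional homogeneous of odd degree. [cite: MagnenRivasseauSeneor1993, §VII p.375 tl.20] -/
theorem integral_homogeneous_odd_eq_zero {F : V → ℝ} {k : ℕ} (hhom : ∀ (c : ℝ) (A : V), F (c • A) = c ^ k * F A)
    (hk : Odd k) : ∫ A, F A ∂μ = 0 :=
  integral_eq_zero_of_odd μ (neg_of_homogeneous_odd hhom hk)

end vertex

/-! ## §4 The centred Gaussian is negation-invariant -/

/-- The centred Gaussian `𝒩(0, v)` on `ℝ` is invariant under `t ↦ −t` (Mathlib `gaussianReal_map_neg`).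
[cite: MagnenRivasseauSeneor1993, §VII p.375 tl.20] -/
theorem isNegInvariant_gaussianReal_zero (v : NNReal) : (gaussianReal 0 v).IsNegInvariant := by
  refine ⟨?_⟩
  rw [Measure.neg_def]
  have h := gaussianReal_map_neg (μ := 0) (v := v)
  rw [neg_zero] at h
  exact h

/-- The one-dimensional cubic vertex has zero Gaussian mean: `∫ c·t³ d𝒩(0,v)(t) = 0`.
[cite: MagnenRivasseauSeneor1993, §VII p.375 tl.20] -/
theorem integral_cubic_gaussianReal_eq_zero (v : NNReal) (c : ℝ) : ∫ t, c * t ^ 3 ∂(gaussianReal 0 v) = 0 := by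
  haveI := isNegInvariant_gaussianReal_zero v
  exact integral_eq_zero_of_odd (gaussianReal 0 v) (F := fun t => c * t ^ 3) (fun t => by ring)

/-! ## §5 (edition v1.1) Every centred Gaussian measure is negation-invariant -/

section gaussian

variable {E : Type*} [NormedAddCommGroup E] [NormedSpace ℝ E] [MeasurableSpace E] [BorelSpace E]

/-- The pushforward of a measure under `A ↦ −A` integrates a continuous linear functional `L` to `−μ[L]` (plumbing).
[folklore] -/
private theorem integral_dual_map_neg (μ : Measure E) (L : StrongDual ℝ E) :
    ∫ x, L x ∂(μ.map Neg.neg) = -∫ x, L x ∂μ := by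
  rw [integral_map (by fun_prop) (by fun_prop)]
  simp only [map_neg, integral_neg]

/-- The pushforward of a measure under `A ↦ −A` gives a continuous linear functional `L` the same variance (plumbing).
[folklore] -/
private theorem variance_dual_map_neg (μ : Measure E) (L : StrongDual ℝ E) :
    Var[L; μ.map Neg.neg] = Var[L; μ] := by
  rw [variance_map (by fun_prop) (by fun_prop)]
  have h : (L : E → ℝ) ∘ (Neg.neg : E → E) = -(L : E → ℝ) := by
    ext x; simp [map_neg]
  rw [h]
  exact variance_neg

variable [SecondCountableTopology E] [CompleteSpace E]

/-- **Every CENTRED Gaussian measure is invariant under `A ↦ −A`.** For a Gaussian measure `μ` on a separable Banach space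
(Mathlib `IsGaussian`) with mean zero (`μ[L] = 0` for every continuous linear `L`), `μ.map (A ↦ −A) = μ`: both are Gaussian with
characteristic functional `exp(−Var[L; μ]/2)`. This is the symmetry behind p.375's «by parity».
[cite: MagnenRivasseauSeneor1993, §VII p.375 tl.20 «by parity a single such vertex vanishes»] -/
theorem isNegInvariant_of_isGaussian_centred (μ : Measure E) [IsGaussian μ]
    (hc : ∀ L : StrongDual ℝ E, μ[L] = 0) : μ.IsNegInvariant := by
  refine ⟨?_⟩
  rw [Measure.neg_def]
  apply Measure.ext_of_charFunDual
  ext L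
  have h1 : ∫ x, L x ∂(μ.map Neg.neg) = ∫ x, L x ∂μ := by
    rw [integral_dual_map_neg, hc L, neg_zero]
  rw [IsGaussian.charFunDual_eq, IsGaussian.charFunDual_eq, integral_complex_ofReal, integral_complex_ofReal, h1,
    variance_dual_map_neg]

/-- Under a centred Gaussian measure every odd functional has zero mean.
[cite: MagnenRivasseauSeneor1993, §VII p.375 tl.20] -/
theorem integral_eq_zero_of_odd_of_isGaussian_centred (μ : Measure E) [IsGaussian μ]
    (hc : ∀ L : StrongDual ℝ E, μ[L] = 0) {F : E → ℝ} (hF : ∀ A, F (-A) = -F A) : ∫ A, F A ∂μ = 0 := by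
  haveI := isNegInvariant_of_isGaussian_centred μ hc
  exact integral_eq_zero_of_odd μ hF

/-- **p.375 «by parity a single such vertex vanishes», Gaussian form**: for every centred Gaussian measure `μ` on the (cut-off,
finite-volume) field space and every trilinear vertex `T`, `∫ T(A,A,A) dμ(A) = 0` — whatever the covariance.
[cite: MagnenRivasseauSeneor1993, §VII p.375 tl.17–20] -/
theorem integral_cubic_eq_zero_of_isGaussian_centred (μ : Measure E) [IsGaussian μ]
    (hc : ∀ L : StrongDual ℝ E, μ[L] = 0) (T : E →ₗ[ℝ] E →ₗ[ℝ] E →ₗ[ℝ] ℝ) : ∫ A, T A A A ∂μ = 0 :=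
  integral_eq_zero_of_odd_of_isGaussian_centred μ hc (cubic_neg T)

end gaussian

section finiteDimensional

/-- The standard Gaussian of a finite-dimensional real inner-product space is negation-invariant — an instance of the parity
symmetry of p.375. [cite: MagnenRivasseauSeneor1993, §VII p.375 tl.20] -/
theorem isNegInvariant_stdGaussian (E : Type*) [NormedAddCommGroup E] [InnerProductSpace ℝ E] [FiniteDimensional ℝ E]
    [MeasurableSpace E] [BorelSpace E] : (stdGaussian E).IsNegInvariant :=
  isNegInvariant_of_isGaussian_centred (stdGaussian E) integral_strongDual_stdGaussian

/-- The centred multivariate Gaussian `𝒩(0, S)` on `ℝ^ι` is negation-invariant, for ANY matrix `S` (Mathlib's `multivariateGaussian`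
is the Dirac mass at the mean when `S` is not positive semidefinite — also negation-invariant at mean `0`) — the finite-dimensional
form of the parity symmetry of p.375. [cite: MagnenRivasseauSeneor1993, §VII p.375 tl.20] -/
theorem isNegInvariant_multivariateGaussian_zero {ι : Type*} [Fintype ι] [DecidableEq ι] (S : Matrix ι ι ℝ) :
    (multivariateGaussian (0 : EuclideanSpace ℝ ι) S).IsNegInvariant := by
  refine isNegInvariant_of_isGaussian_centred _ (fun L => ?_)
  rw [L.integral_comp_id_comm IsGaussian.integrable_id]
  change L (∫ x, x ∂(multivariateGaussian (0 : EuclideanSpace ℝ ι) S)) = 0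
  rw [integral_id_multivariateGaussian, map_zero]

/-- The cubic vertex has zero mean under every centred multivariate Gaussian `𝒩(0, S)`.
[cite: MagnenRivasseauSeneor1993, §VII p.375 tl.17–20] -/
theorem integral_cubic_multivariateGaussian_zero_eq_zero {ι : Type*} [Fintype ι] [DecidableEq ι] (S : Matrix ι ι ℝ)
    (T : EuclideanSpace ℝ ι →ₗ[ℝ] EuclideanSpace ℝ ι →ₗ[ℝ] EuclideanSpace ℝ ι →ₗ[ℝ] ℝ) :
    ∫ A, T A A A ∂(multivariateGaussian (0 : EuclideanSpace ℝ ι) S) = 0 := by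
  haveI := isNegInvariant_multivariateGaussian_zero S
  exact integral_cubic_eq_zero _ T

end finiteDimensional

end Parity

end Literature.MathematicalPhysics.QuantumFieldTheory.MagnenRivasseauSeneor1993
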